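import Literature.AlgebraicGeometry.Motives.ProjClosedFractions
import Literature.AlgebraicGeometry.Motives.SegreEmbedding
import Mathlib.RingTheory.RegularLocalRing.Defs
import HarnessLib

/-!
# Linear forms on a closed subscheme of `ℙ^N_k`: charts, sections and hyperplane sections

Topic: `Literature/AlgebraicGeometry/Resolution`. The geometric dictionary behind "choose general
hyperplanes" (de Jong 1996, 2.11 and the Bertini paragraph of the proof of 4.11; Hartshorne II
8.18): for a morphism `ι : X → ℙ^N_k = Proj k[x₀,…,x_N]` (a closed immersion where stated) and a
coefficient vector `a : Fin (N+1) → k` we set up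

* `LinSec.linForm a = Σ a_l x_l`, the linear form; `LinSec.XL ι a = ι⁻¹ D₊(Σ a_l x_l)`, the open
  complement of the hyperplane section (affine for `ι` affine), and `LinSec.hyp ι a = X ∖ X_a`,
  **the hyperplane section `X ∩ V(Σ a_l x_l)` as a closed subset**;
* on the standard chart `LinSec.chart ι h = ι⁻¹ D₊(x_h)` (affine): the sections
  `LinSec.linSec ι h a = (Σ a_l x_l)/x_h` and `LinSec.coordSec ι h l = x_l/x_h` of `𝒪_X`
  (`Motives.ProjFrac.evalAway`), with `chart h ∩ X_a = X_{linSec h a}`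
  (`chart_inf_XL_eq_basicOpen`), the transition rule
  `linSec h a = (x_{h'}/x_h) · linSec h' a` on `chart h ∩ chart h'` (`map_linSec_eq_mul`) where
  `x_{h'}/x_h` is a unit (`isUnit_germ_coordSec`), and the pointwise criterion
  `x ∈ hyp a ↔ (linSec h a)_x ∈ 𝔪_x` (`mem_hyp_iff_not_isUnit_germ`);
* the ideal `LinSec.cutIdeal ι x a ⊆ 𝒪_{X,x}` generated by the germs of finitely many linear
  forms `a i` (read in any chart through `x`; chart-independent by the transition rule,
  `cutIdeal_eq_span_of_mem`).

Everything is proved; no named facts. Mathlib/tree searched: `Proj.awayToSection`,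
`Proj.awayMap_awayToSection` (through `Motives.ProjFrac.evalAway_awayMap`),
`HomogeneousLocalization.Away.isLocalizationElem`, `Motives.ProjFrac.ZH_mul_eq_basicOpen_evalAway`.

## References

* R. Hartshorne, *Algebraic Geometry* (1977), II Thm. 8.18 (Bertini) and its proof (the linear
  system of hyperplanes, read on affine charts). [Hartshorne1977]
* A. J. de Jong, *Smoothness, semi-stability and alterations*, Publ. Math. IHÉS 83 (1996), 2.11
  and proof of 4.11, p. 68. [DeJong1996]
-/

noncomputable section

open CategoryTheory AlgebraicGeometry TopologicalSpace Opposite HomogeneousLocalization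
open Literature.AlgebraicGeometry.Morphisms.ProjCech (grading PP)
open Literature.AlgebraicGeometry.Motives
open Literature.AlgebraicGeometry.Motives.ProjFrac

attribute [local instance] MvPolynomial.gradedAlgebra
  Literature.AlgebraicGeometry.Motives.ProjBaseChange.algebraBase

namespace Literature.AlgebraicGeometry.Resolution

universe u

namespace LinSec

variable {k : Type u} [Field k] {N : ℕ}

/-! ## Linear forms -/

/-- The linear form `Σ_l a_l x_l ∈ k[x₀, …, x_N]` with coefficient vector `a`. [folklore] -/
def linForm (a : Fin (N + 1) → k) : MvPolynomial (Fin (N + 1)) k :=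
  ∑ l, MvPolynomial.C (a l) * MvPolynomial.X l

/-- A linear form is homogeneous of degree one. [folklore] -/
theorem linForm_mem (a : Fin (N + 1) → k) : linForm a ∈ grading k N 1 := by
  refine Submodule.sum_mem _ fun l _ => ?_
  have := (MvPolynomial.isHomogeneous_C (Fin (N + 1)) (a l)).mul (MvPolynomial.isHomogeneous_X k l)
  simpa using this

/-- The variables are homogeneous of degree one (the tree's `Segre.X_mem` in the `ProjCech`
spelling of the grading). [folklore] -/
theorem X_mem (h : Fin (N + 1)) : (MvPolynomial.X h : MvPolynomial (Fin (N + 1)) k) ∈ grading k N 1 :=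
  MvPolynomial.isHomogeneous_X k h

/-- `linForm` is additive in the coefficient vector. [folklore] -/
theorem linForm_add (a b : Fin (N + 1) → k) : linForm (a + b) = linForm a + linForm b := by
  simp only [linForm, Pi.add_apply, map_add, add_mul, Finset.sum_add_distrib]

/-- `linForm` is homogeneous in the coefficient vector. [folklore] -/
theorem linForm_smul (c : k) (a : Fin (N + 1) → k) :
    linForm (c • a) = MvPolynomial.C c * linForm a := by
  simp only [linForm, Pi.smul_apply, smul_eq_mul, map_mul, mul_assoc, Finset.mul_sum]

/-- The linear form of the `h`-th basis vector is `x_h`. [folklore] -/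
theorem linForm_single (h : Fin (N + 1)) :
    linForm (Pi.single h 1 : Fin (N + 1) → k) = MvPolynomial.X h := by
  classical
  rw [linForm, Finset.sum_eq_single h]
  · simp
  · intro l _ hl
    simp [Pi.single_eq_of_ne hl]
  · intro hh; exact absurd (Finset.mem_univ h) hh

variable {X : Scheme.{u}} (ι : X ⟶ PP k N)

/-! ## The opens `X_a`, the charts, and hyperplane sections as closed subsets -/

/-- `X_a = ι⁻¹ D₊(Σ a_l x_l)`, the complement of the hyperplane section. [folklore] -/
abbrev XL (a : Fin (N + 1) → k) : X.Opens := ZH ι (linForm a)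

/-- The standard chart `ι⁻¹ D₊(x_h)` of `X`. [folklore] -/
abbrev chart (h : Fin (N + 1)) : X.Opens := ZH ι (MvPolynomial.X h)

/-- **The hyperplane section `X ∩ V(Σ a_l x_l)` as a (closed) subset of `X`.** [folklore] -/
def hyp (a : Fin (N + 1) → k) : Set X := ((XL ι a : X.Opens) : Set X)ᶜ

/-- Membership in the hyperplane section, unfolded. [folklore] -/
theorem mem_hyp_iff (a : Fin (N + 1) → k) (x : X) : x ∈ hyp ι a ↔ x ∉ XL ι a := Iff.rfl

/-- Hyperplane sections are closed. [folklore] -/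
theorem isClosed_hyp (a : Fin (N + 1) → k) : IsClosed (hyp ι a) :=
  (XL ι a).isOpen.isClosed_compl

/-- `X_a` is affine for `ι` affine. [folklore] -/
theorem isAffineOpen_XL [IsAffineHom ι] (a : Fin (N + 1) → k) : IsAffineOpen (XL ι a) :=
  isAffineOpen_ZH ι (linForm_mem a) one_pos

/-- The charts are affine for `ι` affine. [folklore] -/
theorem isAffineOpen_chart [IsAffineHom ι] (h : Fin (N + 1)) : IsAffineOpen (chart ι h) :=
  isAffineOpen_ZH ι (X_mem h) one_pos

/-- The chart of `x_h` is `X_{e_h}`. [folklore] -/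
theorem XL_single (h : Fin (N + 1)) : XL ι (Pi.single h 1) = chart ι h := by
  rw [XL, linForm_single]

/-- The standard charts cover `X`. [folklore] -/
theorem iSup_chart : ⨆ h, chart ι h = ⊤ := by
  have hP : ⨆ h : Fin (N + 1), Proj.basicOpen (grading k N) (MvPolynomial.X h) = ⊤ :=
    Proj.iSup_basicOpen_eq_top (grading k N) _ (ProjectiveSpace.irrelevant_le_span N k)
  change ⨆ h, ι ⁻¹ᵁ Proj.basicOpen (grading k N) (MvPolynomial.X h) = ⊤
  rw [← Scheme.Hom.preimage_iSup, hP, Scheme.Hom.preimage_top]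

/-- Every point lies in some chart. [folklore] -/
theorem exists_mem_chart (x : X) : ∃ h, x ∈ chart ι h := by
  have : x ∈ (⨆ h, chart ι h : X.Opens) := by rw [iSup_chart]; trivial
  exact Opens.mem_iSup.mp this

/-! ## The sections `(Σ a_l x_l)/x_h` and `x_l/x_h` over the charts -/

/-- **The section `(Σ_l a_l x_l)/x_h ∈ Γ(chart h, 𝒪_X)`** of the linear form `a` over the
`h`-th chart. [folklore] -/
def linSec (h : Fin (N + 1)) (a : Fin (N + 1) → k) : Γ(X, chart ι h) :=
  evalAway ι (MvPolynomial.X h) (Away.isLocalizationElem (X_mem h) (linForm_mem a))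

/-- **The affine coordinate `x_l/x_h ∈ Γ(chart h, 𝒪_X)`.** [folklore] -/
def coordSec (h l : Fin (N + 1)) : Γ(X, chart ι h) :=
  evalAway ι (MvPolynomial.X h) (Away.isLocalizationElem (X_mem h) (X_mem (k := k) l))

/-- `x_h/x_h = 1`. [folklore] -/
theorem coordSec_self (h : Fin (N + 1)) : coordSec ι h h = 1 := by
  rw [coordSec, show Away.isLocalizationElem (X_mem h) (X_mem (k := k) h) = 1 from
    Segre.frac_self k h, map_one]

/-- The section of the `l`-th basis vector is the coordinate `x_l/x_h`. [folklore] -/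
theorem linSec_single (h l : Fin (N + 1)) : linSec ι h (Pi.single l 1) = coordSec ι h l := by
  simp only [linSec, coordSec, linForm_single]

/-- **`chart h ∩ X_a = X_{(Σ a_l x_l)/x_h}`**: on the chart, `X_a` is the non-vanishing locus of
the section of the linear form. [folklore] -/
theorem chart_inf_XL_eq_basicOpen (h : Fin (N + 1)) (a : Fin (N + 1) → k) :
    chart ι h ⊓ XL ι a = X.basicOpen (linSec ι h a) := by
  change ZH ι _ ⊓ ZH ι _ = _
  rw [← ZH_mul, ZH_mul_eq_basicOpen_evalAway ι (X_mem h) one_pos (linForm_mem a) one_pos]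
  rfl

/-- `chart h ∩ chart h' = X_{x_{h'}/x_h}`. [folklore] -/
theorem chart_inf_chart_eq_basicOpen (h h' : Fin (N + 1)) :
    chart ι h ⊓ chart ι h' = X.basicOpen (coordSec ι h h') := by
  change ZH ι _ ⊓ ZH ι _ = _
  rw [← ZH_mul, ZH_mul_eq_basicOpen_evalAway ι (X_mem h) one_pos (X_mem h') one_pos]
  rfl

/-- **Pointwise criterion**: a point of the `h`-th chart lies on the hyperplane section `V(a)` iff
the germ of `(Σ a_l x_l)/x_h` is not a unit. [folklore] -/
theorem mem_hyp_iff_not_isUnit_germ {h : Fin (N + 1)} {x : X} (hx : x ∈ chart ι h)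
    (a : Fin (N + 1) → k) :
    x ∈ hyp ι a ↔ ¬IsUnit (X.presheaf.germ (chart ι h) x hx (linSec ι h a)) := by
  rw [← Scheme.mem_basicOpen, ← chart_inf_XL_eq_basicOpen, mem_hyp_iff]
  exact ⟨fun h1 h2 => h1 h2.2, fun h1 h2 => h1 ⟨hx, h2⟩⟩

/-- `x_{h'}/x_h` is a unit at the points of `chart h ∩ chart h'`. [folklore] -/
theorem isUnit_germ_coordSec {h h' : Fin (N + 1)} {x : X} (hx : x ∈ chart ι h)
    (hx' : x ∈ chart ι h') : IsUnit (X.presheaf.germ (chart ι h) x hx (coordSec ι h h')) := by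
  rw [← Scheme.mem_basicOpen, ← chart_inf_chart_eq_basicOpen]
  exact ⟨hx, hx'⟩

/-! ## The transition rule -/

/-- The degree-zero fraction identity `(Σ a_l x_l)/x_h = (x_{h'}/x_h) · ((Σ a_l x_l)/x_{h'})` in
`(k[x]_{(x_h x_{h'})})₀`. [folklore] -/
theorem awayMap_linForm_eq_mul (h h' : Fin (N + 1)) (a : Fin (N + 1) → k) :
    awayMap (grading k N) (X_mem h') (rfl : MvPolynomial.X h * MvPolynomial.X h' = _)
        (Away.isLocalizationElem (X_mem h) (linForm_mem a)) =
      awayMap (grading k N) (X_mem h') (rfl : MvPolynomial.X h * MvPolynomial.X h' = _)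
          (Away.isLocalizationElem (X_mem h) (X_mem (k := k) h')) *
        awayMap (grading k N) (X_mem h) (mul_comm (MvPolynomial.X h) (MvPolynomial.X h'))
          (Away.isLocalizationElem (X_mem h') (linForm_mem a)) := by
  apply HomogeneousLocalization.val_injective
  simp only [HomogeneousLocalization.val_mul, awayMap_mk, Away.val_mk, Localization.mk_mul]
  rw [Localization.mk_eq_mk_iff, Localization.r_iff_exists]
  refine ⟨1, ?_⟩
  simp only [OneMemClass.coe_one, one_mul, Submonoid.coe_mul]
  ring

/-- **Transition rule** on `chart h ∩ chart h'`:
`(Σ a_l x_l)/x_h = (x_{h'}/x_h) · (Σ a_l x_l)/x_{h'}`. [folklore] -/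
theorem map_linSec_eq_mul (h h' : Fin (N + 1)) (a : Fin (N + 1) → k) :
    X.presheaf.map (homOfLE (ZH_mono ι ⟨MvPolynomial.X h', rfl⟩)).op (linSec ι h a) =
      X.presheaf.map (homOfLE (ZH_mono ι ⟨MvPolynomial.X h', rfl⟩)).op (coordSec ι h h') *
        X.presheaf.map (homOfLE (ZH_mono ι ⟨MvPolynomial.X h,
          mul_comm (MvPolynomial.X h) (MvPolynomial.X h')⟩)).op (linSec ι h' a) := by
  rw [linSec, linSec, coordSec, ← evalAway_awayMap ι (X_mem h') rfl,
    ← evalAway_awayMap ι (X_mem h') rfl, ← evalAway_awayMap ι (X_mem h) (mul_comm _ _),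
    ← map_mul, awayMap_linForm_eq_mul]

/-- **Transition rule on germs**: at `x ∈ chart h ∩ chart h'`,
`((Σ a_l x_l)/x_h)_x = (x_{h'}/x_h)_x · ((Σ a_l x_l)/x_{h'})_x`. [folklore] -/
theorem germ_linSec_eq_mul {h h' : Fin (N + 1)} {x : X} (hx : x ∈ chart ι h)
    (hx' : x ∈ chart ι h') (a : Fin (N + 1) → k) :
    X.presheaf.germ (chart ι h) x hx (linSec ι h a) =
      X.presheaf.germ (chart ι h) x hx (coordSec ι h h') *
        X.presheaf.germ (chart ι h') x hx' (linSec ι h' a) := by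
  have hxx : x ∈ ZH ι (MvPolynomial.X h * MvPolynomial.X h') := by
    rw [ZH_mul]; exact ⟨hx, hx'⟩
  have e1 := X.presheaf.germ_res_apply (homOfLE (ZH_mono ι ⟨MvPolynomial.X h', rfl⟩)) x hxx
  have e2 := X.presheaf.germ_res_apply (homOfLE (ZH_mono ι ⟨MvPolynomial.X h,
    mul_comm (MvPolynomial.X h) (MvPolynomial.X h')⟩)) x hxx
  rw [← e1 (linSec ι h a), map_linSec_eq_mul, map_mul, e1, e2]

/-- The germs of `(Σ a_l x_l)/x_h` and `(Σ a_l x_l)/x_{h'}` at a point of both charts are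
associated; in particular they generate the same ideal of `𝒪_{X,x}`. [folklore] -/
theorem span_germ_linSec_eq {h h' : Fin (N + 1)} {x : X} (hx : x ∈ chart ι h)
    (hx' : x ∈ chart ι h') (a : Fin (N + 1) → k) :
    Ideal.span {X.presheaf.germ (chart ι h) x hx (linSec ι h a)} =
      Ideal.span {X.presheaf.germ (chart ι h') x hx' (linSec ι h' a)} := by
  rw [germ_linSec_eq_mul ι hx hx' a]
  exact Ideal.span_singleton_mul_left_unit (isUnit_germ_coordSec ι hx hx') _

/-- Being a unit at `x` does not depend on the chart. [folklore] -/
theorem isUnit_germ_linSec_iff {h h' : Fin (N + 1)} {x : X} (hx : x ∈ chart ι h)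
    (hx' : x ∈ chart ι h') (a : Fin (N + 1) → k) :
    IsUnit (X.presheaf.germ (chart ι h) x hx (linSec ι h a)) ↔
      IsUnit (X.presheaf.germ (chart ι h') x hx' (linSec ι h' a)) := by
  rw [← not_iff_not, ← mem_hyp_iff_not_isUnit_germ, ← mem_hyp_iff_not_isUnit_germ]

/-! ## The ideal of `𝒪_{X,x}` cut out by finitely many linear forms -/

/-- **The ideal of `𝒪_{X,x}` generated by the linear forms `a i`** (`i : Fin j`): generated by
the germs of `(Σ_l (a i)_l x_l)/x_h` for ALL charts `h ∋ x` — a chart-free definition, equal to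
the ideal generated through any single chart (`cutIdeal_eq_span_of_mem`). [folklore] -/
def cutIdeal (x : X) {j : ℕ} (a : Fin j → Fin (N + 1) → k) : Ideal (X.presheaf.stalk x) :=
  Ideal.span {g | ∃ (i : Fin j) (h : Fin (N + 1)) (hx : x ∈ chart ι h),
    g = X.presheaf.germ (chart ι h) x hx (linSec ι h (a i))}

/-- **Chart description of the cut ideal**: through a chart `h ∋ x` it is generated by the `j`
germs `((Σ_l (a i)_l x_l)/x_h)_x`. [folklore] -/
theorem cutIdeal_eq_span_of_mem (x : X) {j : ℕ} (a : Fin j → Fin (N + 1) → k) {h : Fin (N + 1)}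
    (hx : x ∈ chart ι h) :
    cutIdeal ι x a =
      Ideal.span (Set.range fun i => X.presheaf.germ (chart ι h) x hx (linSec ι h (a i))) := by
  apply le_antisymm
  · refine Ideal.span_le.mpr ?_
    rintro g ⟨i, h', hx', rfl⟩
    have hle : Ideal.span {X.presheaf.germ (chart ι h') x hx' (linSec ι h' (a i))} ≤
        Ideal.span (Set.range fun i => X.presheaf.germ (chart ι h) x hx (linSec ι h (a i))) := by
      rw [← span_germ_linSec_eq ι hx hx' (a i)]
      exact Ideal.span_mono (Set.singleton_subset_iff.mpr ⟨i, rfl⟩)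
    exact hle (Ideal.subset_span rfl)
  · refine Ideal.span_mono ?_
    rintro g ⟨i, rfl⟩
    exact ⟨i, h, hx, rfl⟩

/-- The cut ideal of the empty family is `0`. [folklore] -/
theorem cutIdeal_zero (x : X) (a : Fin 0 → Fin (N + 1) → k) : cutIdeal ι x a = ⊥ := by
  obtain ⟨h, hx⟩ := exists_mem_chart ι x
  rw [cutIdeal_eq_span_of_mem ι x a hx, Set.range_eq_empty, Ideal.span_empty]

/-- Extending the family by one form adds one generator. [folklore] -/
theorem cutIdeal_snoc (x : X) {j : ℕ} (a : Fin j → Fin (N + 1) → k) (b : Fin (N + 1) → k)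
    {h : Fin (N + 1)} (hx : x ∈ chart ι h) :
    cutIdeal ι x (Fin.snoc a b : Fin (j + 1) → Fin (N + 1) → k) =
      cutIdeal ι x a ⊔ Ideal.span {X.presheaf.germ (chart ι h) x hx (linSec ι h b)} := by
  rw [cutIdeal_eq_span_of_mem ι x _ hx, cutIdeal_eq_span_of_mem ι x _ hx, ← Ideal.span_union]
  congr 1
  ext g
  simp only [Set.mem_range, Set.mem_union, Set.mem_singleton_iff]
  constructor
  · rintro ⟨i, rfl⟩
    refine Fin.lastCases ?_ (fun i => ?_) i
    · exact Or.inr (by simp [Fin.snoc_last])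
    · exact Or.inl ⟨i, by simp [Fin.snoc_castSucc]⟩
  · rintro (⟨i, rfl⟩ | rfl)
    · exact ⟨Fin.castSucc i, by simp [Fin.snoc_castSucc]⟩
    · exact ⟨Fin.last j, by simp [Fin.snoc_last]⟩

/-- The points where all the forms `a i` vanish: the intersection of the hyperplane sections.
[folklore] -/
def cutSet {j : ℕ} (a : Fin j → Fin (N + 1) → k) : Set X := ⋂ i, hyp ι (a i)

/-- The common zero set of finitely many forms is closed. [folklore] -/
theorem isClosed_cutSet {j : ℕ} (a : Fin j → Fin (N + 1) → k) : IsClosed (cutSet ι a) :=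
  isClosed_iInter fun i => isClosed_hyp ι (a i)

/-- `x` lies on all the hyperplanes `V(a i)` iff the cut ideal is a proper ideal of `𝒪_{X,x}`.
[folklore] -/
theorem mem_cutSet_iff_cutIdeal_ne_top (x : X) {j : ℕ} (a : Fin j → Fin (N + 1) → k) :
    x ∈ cutSet ι a ↔ cutIdeal ι x a ≠ ⊤ := by
  obtain ⟨h, hx⟩ := exists_mem_chart ι x
  rw [cutIdeal_eq_span_of_mem ι x a hx, Ne, Ideal.eq_top_iff_one]
  simp only [cutSet, Set.mem_iInter, mem_hyp_iff_not_isUnit_germ ι hx]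
  constructor
  · intro H h1
    -- all generators lie in the maximal ideal, so the span is proper
    have hle : Ideal.span (Set.range fun i => X.presheaf.germ (chart ι h) x hx (linSec ι h (a i))) ≤
        IsLocalRing.maximalIdeal (X.presheaf.stalk x) := by
      refine Ideal.span_le.mpr ?_
      rintro g ⟨i, rfl⟩
      exact (IsLocalRing.mem_maximalIdeal _).mpr (H i)
    exact (IsLocalRing.maximalIdeal.isMaximal _).ne_top (Ideal.eq_top_iff_one _ |>.mpr (hle h1))
  · intro H i hu
    apply H
    have : X.presheaf.germ (chart ι h) x hx (linSec ι h (a i)) ∈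
        Ideal.span (Set.range fun i => X.presheaf.germ (chart ι h) x hx (linSec ι h (a i))) :=
      Ideal.subset_span ⟨i, rfl⟩
    exact Ideal.eq_top_of_isUnit_mem _ this hu ▸ Submodule.mem_top

/-! ## Points of a chart: prime ideals of `Γ(chart h, 𝒪_X)` and local rings -/

section Points

variable [IsAffineHom ι]

/-- The prime ideal `𝔭_x ⊂ Γ(chart h, 𝒪_X)` of a point `x` of the (affine) chart (Mathlib
`IsAffineOpen.primeIdealOf`). [folklore] -/
def ptIdeal (h : Fin (N + 1)) (x : X) (hx : x ∈ chart ι h) : Ideal Γ(X, chart ι h) :=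
  ((isAffineOpen_chart ι h).primeIdealOf ⟨x, hx⟩).asIdeal

/-- `𝔭_x` is prime. [folklore] -/
instance ptIdeal_isPrime (h : Fin (N + 1)) (x : X) (hx : x ∈ chart ι h) :
    (ptIdeal ι h x hx).IsPrime :=
  ((isAffineOpen_chart ι h).primeIdealOf ⟨x, hx⟩).isPrime

/-- The prime ideal of a closed point is maximal. [folklore] -/
theorem ptIdeal_isMaximal (h : Fin (N + 1)) {x : X} (hx : x ∈ chart ι h)
    (hxc : IsClosed ({x} : Set X)) : (ptIdeal ι h x hx).IsMaximal :=
  (isAffineOpen_chart ι h).primeIdealOf_isMaximal_of_isClosed ⟨x, hx⟩ hxc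

/-- `𝒪_{X,x}` is the localisation of `Γ(chart h, 𝒪_X)` at `𝔭_x` (Mathlib
`IsAffineOpen.isLocalization_stalk`), for the algebra structure given by the germ map. [folklore] -/
theorem isLocalization_stalk (h : Fin (N + 1)) (x : X) (hx : x ∈ chart ι h) :
    @IsLocalization.AtPrime _ _ (X.presheaf.stalk x) _
      (X.presheaf.germ (chart ι h) x hx).hom.toAlgebra (ptIdeal ι h x hx) _ :=
  (isAffineOpen_chart ι h).isLocalization_stalk ⟨x, hx⟩

/-- **Membership in `𝔭_x`**: a section lies in `𝔭_x` iff its germ at `x` is not a unit.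
[folklore] -/
theorem mem_ptIdeal_iff (h : Fin (N + 1)) {x : X} (hx : x ∈ chart ι h) (s : Γ(X, chart ι h)) :
    s ∈ ptIdeal ι h x hx ↔ ¬IsUnit (X.presheaf.germ (chart ι h) x hx s) := by
  letI := (X.presheaf.germ (chart ι h) x hx).hom.toAlgebra
  haveI := isLocalization_stalk ι h x hx
  rw [← IsLocalization.AtPrime.to_map_mem_maximal_iff (X.presheaf.stalk x) (ptIdeal ι h x hx) s,
    IsLocalRing.mem_maximalIdeal, mem_nonunits_iff]
  rfl

/-- A point of the chart lies on `V(a)` iff `(Σ a_l x_l)/x_h ∈ 𝔭_x`. [folklore] -/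
theorem mem_hyp_iff_linSec_mem_ptIdeal (h : Fin (N + 1)) {x : X} (hx : x ∈ chart ι h)
    (a : Fin (N + 1) → k) : x ∈ hyp ι a ↔ linSec ι h a ∈ ptIdeal ι h x hx := by
  rw [mem_ptIdeal_iff, mem_hyp_iff_not_isUnit_germ ι hx]

/-- **`𝒪_{X,x} ≅ Γ(chart h, 𝒪_X)_{𝔭_x}`** as rings. [folklore] -/
def stalkEquivAt (h : Fin (N + 1)) (x : X) (hx : x ∈ chart ι h) :
    Localization.AtPrime (ptIdeal ι h x hx) ≃+* X.presheaf.stalk x :=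
  letI := (X.presheaf.germ (chart ι h) x hx).hom.toAlgebra
  haveI := isLocalization_stalk ι h x hx
  (IsLocalization.algEquiv (ptIdeal ι h x hx).primeCompl
    (Localization.AtPrime (ptIdeal ι h x hx)) (X.presheaf.stalk x)).toRingEquiv

/-- `stalkEquivAt` sends `s/1` to the germ of `s`. [folklore] -/
@[simp]
theorem stalkEquivAt_algebraMap (h : Fin (N + 1)) (x : X) (hx : x ∈ chart ι h)
    (s : Γ(X, chart ι h)) :
    stalkEquivAt ι h x hx (algebraMap _ _ s) = X.presheaf.germ (chart ι h) x hx s := by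
  letI := (X.presheaf.germ (chart ι h) x hx).hom.toAlgebra
  haveI := isLocalization_stalk ι h x hx
  change IsLocalization.algEquiv (ptIdeal ι h x hx).primeCompl
    (Localization.AtPrime (ptIdeal ι h x hx)) (X.presheaf.stalk x) (algebraMap _ _ s) = _
  rw [IsLocalization.algEquiv_apply, IsLocalization.map_eq, RingHom.id_apply]
  rfl

/-- `stalkEquivAt` composed with the structure map is the germ map. [folklore] -/
theorem stalkEquivAt_comp_algebraMap (h : Fin (N + 1)) (x : X) (hx : x ∈ chart ι h) :
    (stalkEquivAt ι h x hx).toRingHom.comp (algebraMap Γ(X, chart ι h) _) =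
      (X.presheaf.germ (chart ι h) x hx).hom :=
  RingHom.ext fun s => stalkEquivAt_algebraMap ι h x hx s

/-- **The ideal of `Γ(chart h, 𝒪_X)` generated by the sections of the forms `a i`.** [folklore] -/
def secIdeal (h : Fin (N + 1)) {j : ℕ} (a : Fin j → Fin (N + 1) → k) : Ideal Γ(X, chart ι h) :=
  Ideal.span (Set.range fun i => linSec ι h (a i))

omit [IsAffineHom ι] in
/-- The cut ideal of `𝒪_{X,x}` is the extension of `secIdeal` along the germ map. [folklore] -/
theorem cutIdeal_eq_map_secIdeal (h : Fin (N + 1)) {x : X} (hx : x ∈ chart ι h) {j : ℕ}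
    (a : Fin j → Fin (N + 1) → k) :
    cutIdeal ι x a = (secIdeal ι h a).map (X.presheaf.germ (chart ι h) x hx).hom := by
  rw [cutIdeal_eq_span_of_mem ι x a hx, secIdeal, Ideal.map_span, ← Set.range_comp]
  rfl

/-- The cut ideal read in `Γ(chart h, 𝒪_X)_{𝔭_x}`: it corresponds to the extension of `secIdeal`
under `stalkEquivAt`. [folklore] -/
theorem cutIdeal_eq_map_stalkEquivAt (h : Fin (N + 1)) {x : X} (hx : x ∈ chart ι h) {j : ℕ}
    (a : Fin j → Fin (N + 1) → k) :
    cutIdeal ι x a = ((secIdeal ι h a).map (algebraMap _ (Localization.AtPrime (ptIdeal ι h x hx)))).map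
      (stalkEquivAt ι h x hx : Localization.AtPrime (ptIdeal ι h x hx) →+* X.presheaf.stalk x) := by
  rw [cutIdeal_eq_map_secIdeal ι h hx, Ideal.map_map]
  congr 1
  exact (stalkEquivAt_comp_algebraMap ι h x hx).symm

/-- **Regularity modulo the forms, read in the chart ring**:
`𝒪_{X,x}/(a₀, …, a_{j-1})` is a regular local ring iff `Γ(chart h)_{𝔭_x}/(a₀, …, a_{j-1})` is.
[folklore] -/
theorem isRegularLocalRing_quotient_cutIdeal_iff (h : Fin (N + 1)) {x : X} (hx : x ∈ chart ι h)
    {j : ℕ} (a : Fin j → Fin (N + 1) → k) :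
    IsRegularLocalRing (X.presheaf.stalk x ⧸ cutIdeal ι x a) ↔
      IsRegularLocalRing (Localization.AtPrime (ptIdeal ι h x hx) ⧸
        (secIdeal ι h a).map (algebraMap _ (Localization.AtPrime (ptIdeal ι h x hx)))) := by
  have e := Ideal.quotientEquiv _ _ (stalkEquivAt ι h x hx) (cutIdeal_eq_map_stalkEquivAt ι h hx a)
  exact ⟨fun H => IsRegularLocalRing.of_ringEquiv e.symm, fun H => IsRegularLocalRing.of_ringEquiv e⟩

/-- Regularity of `𝒪_{X,x}` read in the chart ring. [folklore] -/
theorem isRegularLocalRing_stalk_iff (h : Fin (N + 1)) {x : X} (hx : x ∈ chart ι h) :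
    IsRegularLocalRing (X.presheaf.stalk x) ↔
      IsRegularLocalRing (Localization.AtPrime (ptIdeal ι h x hx)) :=
  ⟨fun _ => IsRegularLocalRing.of_ringEquiv (stalkEquivAt ι h x hx).symm,
    fun _ => IsRegularLocalRing.of_ringEquiv (stalkEquivAt ι h x hx)⟩

end Points

/-! ## The chart ring as a `k`-algebra generated by the affine coordinates -/

section ChartAlgebra

/-- **The `k`-algebra structure on `Γ(chart h, 𝒪_X)`**: constants are the pull-backs of the
constant degree-zero fractions `c/1`. (A definition, made a local instance where needed.)
[folklore] -/
@[reducible]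
def chartAlgebra (h : Fin (N + 1)) : Algebra k Γ(X, chart ι h) :=
  ((evalAway ι (MvPolynomial.X h)).comp
    (algebraMap k (Away (grading k N) (MvPolynomial.X h)))).toAlgebra

attribute [local instance] chartAlgebra

/-- Unfolding the structure map of the chart algebra. [folklore] -/
theorem algebraMap_chart_apply (h : Fin (N + 1)) (c : k) :
    algebraMap k Γ(X, chart ι h) c =
      evalAway ι (MvPolynomial.X h) (algebraMap k (Away (grading k N) (MvPolynomial.X h)) c) :=
  rfl

/-- `evalAway` as a `k`-algebra homomorphism onto the chart ring. [folklore] -/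
def evalAwayₐ (h : Fin (N + 1)) : Away (grading k N) (MvPolynomial.X h) →ₐ[k] Γ(X, chart ι h) :=
  { evalAway ι (MvPolynomial.X h) with commutes' := fun _ => rfl }

/-- `evalAwayₐ` is `evalAway`. [folklore] -/
@[simp]
theorem evalAwayₐ_apply (h : Fin (N + 1)) (z : Away (grading k N) (MvPolynomial.X h)) :
    evalAwayₐ ι h z = evalAway ι (MvPolynomial.X h) z := rfl

/-- The tree's chart generator `x_{h.succAbove j}/x_h` is the element `x_l/x_h` used here.
[folklore] -/
theorem chartGen_eq (h : Fin (N + 1)) (j : Fin N) :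
    ProjectiveSpace.chartGen k h j =
      Away.isLocalizationElem (X_mem h) (X_mem (k := k) (h.succAbove j)) := by
  apply HomogeneousLocalization.val_injective
  rw [ProjectiveSpace.val_chartGen, Away.val_mk]
  simp

/-- **`Γ(chart h, 𝒪_X)` is generated by the affine coordinates `x_l/x_h`** (for `ι` a closed
immersion: it is a quotient of `(k[x]_{(x_h)})₀ = k[x_l/x_h]`). [folklore] -/
theorem adjoin_coordSec_eq_top [IsClosedImmersion ι] (h : Fin (N + 1)) :
    Algebra.adjoin k (Set.range (coordSec ι h)) = ⊤ := by
  refine top_le_iff.mp fun s _ => ?_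
  obtain ⟨z, rfl⟩ := evalAway_surjective ι (X_mem h) one_pos s
  obtain ⟨p, rfl⟩ : ∃ p, ProjectiveSpace.toChart k h p = z :=
    ⟨ProjectiveSpace.ofChart k h z, ProjectiveSpace.toChart_ofChart h z⟩
  have hcomp : (evalAwayₐ ι h).comp (ProjectiveSpace.toChart k h) =
      MvPolynomial.aeval fun j => coordSec ι h (h.succAbove j) := by
    refine MvPolynomial.algHom_ext fun j => ?_
    simp only [AlgHom.coe_comp, Function.comp_apply, MvPolynomial.aeval_X, ProjectiveSpace.toChart,
      evalAwayₐ_apply, chartGen_eq]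
    rfl
  have : evalAway ι (MvPolynomial.X h) (ProjectiveSpace.toChart k h p) =
      MvPolynomial.aeval (fun j => coordSec ι h (h.succAbove j)) p := by
    rw [← evalAwayₐ_apply, ← AlgHom.comp_apply, hcomp]
  rw [this]
  have hmem : MvPolynomial.aeval (fun j => coordSec ι h (h.succAbove j)) p ∈
      Algebra.adjoin k (Set.range fun j => coordSec ι h (h.succAbove j)) := by
    rw [← MvPolynomial.aeval_range]; exact ⟨p, rfl⟩
  have hsub : (Set.range fun j => coordSec ι h (h.succAbove j)) ⊆ Set.range (coordSec ι h) :=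
    Set.range_subset_iff.mpr fun j => Set.mem_range_self (f := coordSec ι h) (h.succAbove j)
  exact Algebra.adjoin_mono hsub hmem

/-- **`Γ(chart h, 𝒪_X)` is of finite type over `k`** (for `ι` a closed immersion). [folklore] -/
theorem finiteType_chart [IsClosedImmersion ι] (h : Fin (N + 1)) :
    Algebra.FiniteType k Γ(X, chart ι h) :=
  Algebra.FiniteType.of_surjective ((evalAwayₐ ι h).comp (ProjectiveSpace.toChart k h))
    (fun s => by
      obtain ⟨z, rfl⟩ := evalAway_surjective ι (X_mem h) one_pos s
      exact ⟨ProjectiveSpace.ofChart k h z, by simp [ProjectiveSpace.toChart_ofChart]⟩)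

/-- **The section of a linear form is the linear combination of the coordinates**:
`(Σ a_l x_l)/x_h = Σ a_l · (x_l/x_h)`. [folklore] -/
theorem linSec_eq_sum (h : Fin (N + 1)) (a : Fin (N + 1) → k) :
    linSec ι h a = ∑ l, a l • coordSec ι h l := by
  have hA : Away.isLocalizationElem (X_mem h) (linForm_mem a) =
      ∑ l, algebraMap k (Away (grading k N) (MvPolynomial.X h)) (a l) *
        Away.isLocalizationElem (X_mem h) (X_mem (k := k) l) := by
    apply HomogeneousLocalization.val_injective
    conv_rhs => rw [← HomogeneousLocalization.algebraMap_apply, map_sum]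
    simp only [map_mul, HomogeneousLocalization.algebraMap_apply, ProjBaseChange.val_algebraMap,
      Away.val_mk, pow_one]
    have hc : ∀ c : k, algebraMap k (Localization.Away (MvPolynomial.X h :
        MvPolynomial (Fin (N + 1)) k)) c = Localization.mk (MvPolynomial.C c) 1 := fun c => by
      rw [IsScalarTower.algebraMap_apply k (MvPolynomial (Fin (N + 1)) k) (Localization _),
        MvPolynomial.algebraMap_eq, Localization.mk_one_eq_algebraMap]
    simp only [hc, Localization.mk_mul, one_mul, linForm, Localization.mk_sum]
  simp only [linSec, coordSec, hA, map_sum, map_mul]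
  rfl

end ChartAlgebra

end LinSec

end Literature.AlgebraicGeometry.Resolution
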